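import Literature.NumberTheory.EllipticCurves.GaloisConjugateReductionLayerProofs
import Literature.NumberTheory.EllipticCurves.KodairaNeronUnramifiedInertiaProofs
import Literature.NumberTheory.EllipticCurves.SelmerFiniteProofs
import Literature.NumberTheory.EllipticCurves.SelmerInertia
import Literature.NumberTheory.EllipticCurves.ComplexMultiplicationTwistIsogenyProofs
import HarnessLib

/-!
# Crux `PrintCf2.SplitBadTwoRankOneOfFacts` (stmt-BirchSwinnertonDyer-20368), road α v11.1, S3b′ brick (FIN) via (ET): the KERNEL OF
# REDUCTION at a place of a NUMBER FIELD for a given good integral model — Greenberg's `C_v` and its Kummer compatibility, `K`-generic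

Cell `bsd-print-cf2`, EXTRA WIDTH seat `bsd-line-cf2-p1-w8` g3 (prover-bsd-line-cf2-p1-w8-g3-0); `--supports stmt-BirchSwinnertonDyer-20368`
(helper, Theses-free). HONEST FRAMING: nothing here closes the crux or a registered stub; BSD is not proved by any of this; no summit
statement is proved by this seat. No definition, no named fact, no `sorry`, no kit. beyond-print theorem: no.

WHY ((ET) piece (B1) of TURNKEY-20368-ET-w3g10 §2, LEAD cf2-p1 g13 ASSIGN 2026-08-29T01:09:03Z). The local statement (ET-v)/(ET-v̄) «the étale
component of a Kummer class at a dyadic place is `2`-torsion» rests on Greenberg's «`Im κ ⊆ Im H¹(C)`» step: for `σ` in the local INERTIA group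
and any point `R` over `K̄_w`, `σR − R` lies in the kernel of reduction of a model with GOOD reduction (LNM 1716 §2, Props. 2.2/2.4). X2's
`GreenbergVatsalReductionDatum` (`localRed`, `reductionDatum_kummer`) packages this for a globally minimal `E/ℚ` at a place of `ℚ` ONLY; the
S3b′ frames live over `K = ℚ(√−7)` at `v ∣ 2` with `K_v = ℚ₂` and the good model is the CM curve `cm7` over the valuation ring of `K̄_v` (the twist
`W` becomes isomorphic to it over `K_v(√d)`). THIS FILE gives the `K`-GENERIC form, with NO transport `ℚ₂ ↔ K_v`: for ANY number field `K`, place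
`v`, curve `V/K` and ANY Weierstrass model `M` over the valuation ring `𝒪_w` of the spectral valuation `w` of `K̄_v` with `Δ(M) ∈ 𝒪_wˣ` and
`M ⊗ K̄_v = V ⊗ K̄_v`, the reduction homomorphism `red = goodReductionHom M ∘ congrEquiv : E(K̄_v) → M̃(k̄)` (Literature `goodReductionHom`,
Silverman VII.2.1) satisfies:
* `reduction_smul_of_mem_absInertia` — `red (σ P) = red P` for `σ ∈ I_{K_v}` (`reducePoint_congrEquiv_smul_eq_of_val`,
  `mem_inertia_iff_spectralValuation`, `inertia_eq_absInertia`): inertia acts trivially on the reduction;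
* `reduction_smul_eq_zero_iff` — `red (σ P) = 0 ↔ red P = 0` for every `σ ∈ Γ_{K_v}` (`reducesToZero_congrEquiv_map_iff`): the kernel of
  reduction is `Γ_{K_v}`-stable;
* `reduction_sub_eq_zero_of_mem_absInertia` — **`red (σ P − P) = 0`**: Greenberg's Kummer compatibility (X2 `reductionDatum_kummer`, now over `K`);
* `reduction_some_ne_zero_of_le_one` — a point with `w`-INTEGRAL `x`-coordinate is NOT in the kernel of reduction (`reducesToZero_some_iff`);
* `exists_reductionKernel` — the same four facts packaged for the subgroup `𝒦 = ker red ≤ E(K̄_v)` (definition-free consumer form).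
Consumers: the (ET) transport (next files: `M :=` the `cm7` equation over `𝒪_w`, `Δ = −7³` a unit at `v ∣ 2`; the twist equivalence of -w5/Additive
`exists_addEquiv_geomPoints_of_model_twist_sign` on `K̄_v`-points; `𝒦 ∩ E[2^∞] = W*′` from the frame's local types).
presearch: Silverman AEC VII.2.1, VIII §1; Greenberg LNM 1716 §2 pp. 70–75; Greenberg–Vatsal 2000 p. 14 — tree theorems (Literature reduction layer,
X2 for `ℚ`); no new fact. playbook: none fit.

References: [SilvermanAEC2009] Prop. VII.2.1, VII.§2, VIII.§1; [GreenbergLNM1716] §2 pp. 69–75 (Props. 2.2, 2.4); [GreenbergVatsal2000] §2 p. 14;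
[NeukirchANT1999] II (4.8), (6.2), (9.3).
-/

noncomputable section

open scoped Classical NNReal

set_option linter.dupNamespace false
set_option autoImplicit false

open NumberField IsDedekindDomain Field WeierstrassCurve
open Literature.NumberTheory.EllipticCurves Literature.NumberTheory.GaloisRepresentations
open IsDedekindDomain.HeightOneSpectrum

namespace Summit.BirchSwinnertonDyer.BirchSwinnertonDyer.Theorems.PrintCf2.ReductionKernel

universe u

variable {K : Type u} [Field K] [NumberField K] {v : HeightOneSpectrum (𝓞 K)} (V : WeierstrassCurve K)
  {w : Valuation (AlgebraicClosure (v.adicCompletion K)) ℝ≥0}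
  (hw : ∀ x, (w x : ℝ) = spectralNorm (v.adicCompletion K) (AlgebraicClosure (v.adicCompletion K)) x)
  (M : WeierstrassCurve ↥w.valuationSubring) (hΔ : IsUnit M.Δ)
  (hM : M.baseChange (AlgebraicClosure (v.adicCompletion K)) = V.baseChange (AlgebraicClosure (v.adicCompletion K)))

/-- Unfolding the reduction homomorphism of a good model on `E(K̄_v)`: it is the tree's `reducePoint` of the transported point. [folklore] -/
theorem reduction_apply (P : localPoints V (v.adicCompletion K)) :
    ((goodReductionHom M (Valuation.valuationSubring.integers w) hΔ).comp
        (Affine.Point.congrEquiv hM.symm).toAddMonoidHom : localPoints V (v.adicCompletion K) →+ _) P =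
      M.reducePoint (Affine.Point.congrEquiv hM.symm P) :=
  rfl

include hw in
/-- **The local INERTIA group does not change the reduction**: `red (σ P) = red P` for `σ ∈ I_{K_v}` and every `P ∈ E(K̄_v)` — the model has
coefficients in `𝒪_w` and `σ` moves `w`-integers within their residue classes (Neukirch II (9.3)). X2 `localRed_smul_of_mem_absInertia` over any
number field. [cite: SilvermanAEC2009, VIII.§1 and VII.§2] [cite: NeukirchANT1999, II (9.3)] -/
theorem reduction_smul_of_mem_absInertia {σ : absoluteGaloisGroup (v.adicCompletion K)}
    (hσ : σ ∈ absInertia (v.adicCompletion K)) (P : localPoints V (v.adicCompletion K)) :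
    ((goodReductionHom M (Valuation.valuationSubring.integers w) hΔ).comp
        (Affine.Point.congrEquiv hM.symm).toAddMonoidHom : localPoints V (v.adicCompletion K) →+ _) (σ • P) =
      ((goodReductionHom M (Valuation.valuationSubring.integers w) hΔ).comp
        (Affine.Point.congrEquiv hM.symm).toAddMonoidHom : localPoints V (v.adicCompletion K) →+ _) P := by
  obtain ⟨𝔐, h𝔐⟩ := v.localPrimesAbove_nonempty
  have hσ' : σ ∈ 𝔐.inertia (absoluteGaloisGroup (v.adicCompletion K)) := by
    rw [inertia_eq_absInertia hw h𝔐]; exact hσ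
  have hmove := (mem_inertia_iff_spectralValuation hw h𝔐).1 hσ'
  rw [reduction_apply V M hΔ hM, reduction_apply V M hΔ hM]
  exact reducePoint_congrEquiv_smul_eq_of_val hw hM σ P (fun x y _ _ ↦ ⟨hmove x, hmove y⟩)

include hw in
/-- **The kernel of reduction is `Γ_{K_v}`-stable**: `red (σ P) = 0 ↔ red P = 0` (`σ` is a `w`-isometry). X2 `localRed_smul_eq_zero_iff` over any
number field. [cite: SilvermanAEC2009, VII.§2 and VIII.§1] -/
theorem reduction_smul_eq_zero_iff (σ : absoluteGaloisGroup (v.adicCompletion K)) (P : localPoints V (v.adicCompletion K)) :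
    ((goodReductionHom M (Valuation.valuationSubring.integers w) hΔ).comp
        (Affine.Point.congrEquiv hM.symm).toAddMonoidHom : localPoints V (v.adicCompletion K) →+ _) (σ • P) = 0 ↔
      ((goodReductionHom M (Valuation.valuationSubring.integers w) hΔ).comp
        (Affine.Point.congrEquiv hM.symm).toAddMonoidHom : localPoints V (v.adicCompletion K) →+ _) P = 0 := by
  rw [reduction_apply V M hΔ hM, reduction_apply V M hΔ hM]
  change goodReductionHom _ (Valuation.valuationSubring.integers w) hΔ _ = 0 ↔
    goodReductionHom _ (Valuation.valuationSubring.integers w) hΔ _ = 0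
  rw [goodReductionHom_eq_zero_iff, goodReductionHom_eq_zero_iff, localPoints.smul_def]
  exact reducesToZero_congrEquiv_map_iff _ hM.symm _ (fun z ↦ spectralValuation_smul hw σ z) _

include hw in
/-- **Greenberg's KUMMER COMPATIBILITY over a number field**: for `σ` in the local inertia group and ANY `P ∈ E(K̄_v)`, the point `σP − P`
reduces to `O` — `red (σP) = red P`. This is the step «`Im κ_v ⊆ Im (H¹(C) → H¹(A))`» of LNM 1716 §2 (Props. 2.2/2.4) in the one direction
needed; X2 `reductionDatum_kummer` over any number field. [cite: GreenbergLNM1716, §2 pp. 70–75] [cite: GreenbergVatsal2000, §2 p. 14] -/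
theorem reduction_sub_eq_zero_of_mem_absInertia {σ : absoluteGaloisGroup (v.adicCompletion K)}
    (hσ : σ ∈ absInertia (v.adicCompletion K)) (P : localPoints V (v.adicCompletion K)) :
    ((goodReductionHom M (Valuation.valuationSubring.integers w) hΔ).comp
        (Affine.Point.congrEquiv hM.symm).toAddMonoidHom : localPoints V (v.adicCompletion K) →+ _) (σ • P - P) = 0 := by
  rw [map_sub, reduction_smul_of_mem_absInertia V hw M hΔ hM hσ P, sub_self]

/-- **A point with `w`-integral `x`-coordinate does not reduce to `O`** (the kernel of reduction is `{O} ∪ {(x, y) : w x > 1}`, Silverman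
VII.2.1–2.2). [cite: SilvermanAEC2009, Prop. VII.2.1 and VII.2.2] -/
theorem reduction_some_ne_zero_of_le_one {x y : AlgebraicClosure (v.adicCompletion K)}
    (h : (V.baseChange (AlgebraicClosure (v.adicCompletion K))).toAffine.Nonsingular x y) (hx : w x ≤ 1) :
    ((goodReductionHom M (Valuation.valuationSubring.integers w) hΔ).comp
        (Affine.Point.congrEquiv hM.symm).toAddMonoidHom : localPoints V (v.adicCompletion K) →+ _) (Affine.Point.some x y h) ≠ 0 := by
  rw [reduction_apply V M hΔ hM]
  change goodReductionHom _ (Valuation.valuationSubring.integers w) hΔ _ ≠ 0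
  rw [Ne, goodReductionHom_eq_zero_iff, Affine.Point.congrEquiv_some, reducesToZero_some_iff, not_not]
  exact ⟨⟨x, (Valuation.mem_valuationSubring_iff w x).mpr hx⟩, rfl⟩

include hw M hΔ hM in
/-- **THE KERNEL OF REDUCTION `𝒦 ≤ E(K̄_v)` (definition-free consumer form).** For a number field `K`, a place `v`, a curve `V/K` and a Weierstrass
model `M` over the valuation ring of `K̄_v` with unit discriminant and `M ⊗ K̄_v = V ⊗ K̄_v`, there is a subgroup `𝒦` of `E(K̄_v)` which is
(i) `Γ_{K_v}`-stable, (ii) contains `σP − P` for every `σ` in the inertia group and every `P` (Greenberg's Kummer compatibility), and (iii) contains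
no affine point with `w`-integral `x`-coordinate. (`𝒦 = ker red`.) [cite: GreenbergLNM1716, §2 pp. 70–75] [cite: SilvermanAEC2009, Prop. VII.2.1] -/
theorem exists_reductionKernel :
    ∃ 𝒦 : AddSubgroup (localPoints V (v.adicCompletion K)),
      (∀ (σ : absoluteGaloisGroup (v.adicCompletion K)) (P : localPoints V (v.adicCompletion K)), σ • P ∈ 𝒦 ↔ P ∈ 𝒦) ∧
      (∀ σ ∈ absInertia (v.adicCompletion K), ∀ P : localPoints V (v.adicCompletion K), σ • P - P ∈ 𝒦) ∧
      (∀ (x y : AlgebraicClosure (v.adicCompletion K)) (h : (V.baseChange (AlgebraicClosure (v.adicCompletion K))).toAffine.Nonsingular x y),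
        w x ≤ 1 → (Affine.Point.some x y h : localPoints V (v.adicCompletion K)) ∉ 𝒦) := by
  refine ⟨((goodReductionHom M (Valuation.valuationSubring.integers w) hΔ).comp
      (Affine.Point.congrEquiv hM.symm).toAddMonoidHom : localPoints V (v.adicCompletion K) →+ _).ker,
    fun σ P ↦ ?_, fun σ hσ P ↦ ?_, fun x y h hx ↦ ?_⟩
  · rw [AddMonoidHom.mem_ker, AddMonoidHom.mem_ker]
    exact reduction_smul_eq_zero_iff V hw M hΔ hM σ P
  · exact (AddMonoidHom.mem_ker).mpr (reduction_sub_eq_zero_of_mem_absInertia V hw M hΔ hM hσ P)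
  · exact fun hmem ↦ reduction_some_ne_zero_of_le_one V M hΔ hM h hx ((AddMonoidHom.mem_ker).mp hmem)

/-! ## The CM curve `cm7 = [1, −1, 0, −2, −1]` (`49a1`, `Δ = −7³`) at a place `v ∤ 7` of any number field -/

include hw in
/-- **THE KERNEL OF REDUCTION OF `cm7` AT A PLACE `v ∤ 7` OF A NUMBER FIELD `K`** (e.g. `v ∣ 2` of `K = ℚ(√−7)`, the S3b′ frames): the integral
equation `y² + xy = x³ − x² − 2x − 1` over the valuation ring of `K̄_v` has unit discriminant `−7³`, so `exists_reductionKernel` applies to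
`cm7 ⊗ K`: a `Γ_{K_v}`-stable subgroup `𝒦 ≤ cm7(K̄_v)` containing every `σP − P` (`σ` in the inertia group) and no point with integral abscissa —
in particular not the rational `2`-torsion point `(2, −1)`. [cite: SilvermanAEC2009, Prop. VII.2.1 and VII.5.1(a)] [cite: GreenbergLNM1716, §2 pp. 70–75] -/
theorem exists_reductionKernel_cm7 (hv7 : ((7 : ℤ) : 𝓞 K) ∉ v.asIdeal) :
    ∃ 𝒦 : AddSubgroup (localPoints (cm7.baseChange K) (v.adicCompletion K)),
      (∀ (σ : absoluteGaloisGroup (v.adicCompletion K)) (P : localPoints (cm7.baseChange K) (v.adicCompletion K)), σ • P ∈ 𝒦 ↔ P ∈ 𝒦) ∧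
      (∀ σ ∈ absInertia (v.adicCompletion K), ∀ P : localPoints (cm7.baseChange K) (v.adicCompletion K), σ • P - P ∈ 𝒦) ∧
      (∀ (x y : AlgebraicClosure (v.adicCompletion K))
        (h : ((cm7.baseChange K).baseChange (AlgebraicClosure (v.adicCompletion K))).toAffine.Nonsingular x y),
        w x ≤ 1 → (Affine.Point.some x y h : localPoints (cm7.baseChange K) (v.adicCompletion K)) ∉ 𝒦) := by
  set O : ValuationSubring (AlgebraicClosure (v.adicCompletion K)) := w.valuationSubring with hO
  set M : WeierstrassCurve ↥O := ⟨1, -1, 0, -2, -1⟩ with hMdef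
  have hM : M.baseChange (AlgebraicClosure (v.adicCompletion K)) =
      (cm7.baseChange K).baseChange (AlgebraicClosure (v.adicCompletion K)) := by
    have h2 : ((2 : ↥O) : AlgebraicClosure (v.adicCompletion K)) = 2 := by
      rw [show (2 : ↥O) = 1 + 1 from by norm_num]; push_cast; norm_num
    ext <;> simp [hMdef, WeierstrassCurve.baseChange, WeierstrassCurve.map, map_ofNat, h2]
  have h343 : ((-343 : ℤ) : 𝓞 K) ∉ v.asIdeal := by
    intro h
    have h' : ((7 : ℤ) : 𝓞 K) ^ 3 ∈ v.asIdeal := by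
      have : ((-343 : ℤ) : 𝓞 K) = -(((7 : ℤ) : 𝓞 K) ^ 3) := by push_cast; ring
      rw [this] at h
      exact (neg_mem_iff).mp h
    exact hv7 (v.isPrime.mem_of_pow_mem 3 h')
  have hΔ : IsUnit M.Δ := by
    rw [(Valuation.valuationSubring.integers (v := w)).isUnit_iff_valuation_eq_one]
    have h1 : (algebraMap (↥O) (AlgebraicClosure (v.adicCompletion K)) M.Δ) =
        (M.baseChange (AlgebraicClosure (v.adicCompletion K))).Δ := by
      rw [WeierstrassCurve.baseChange, WeierstrassCurve.map_Δ]
    have h2 : ((cm7.baseChange K).baseChange (AlgebraicClosure (v.adicCompletion K))).Δ =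
        ((-343 : ℤ) : AlgebraicClosure (v.adicCompletion K)) := by
      rw [WeierstrassCurve.baseChange, WeierstrassCurve.map_Δ, WeierstrassCurve.baseChange, WeierstrassCurve.map_Δ, Δ_cm7]
      simp only [map_neg, map_pow, map_ofNat, Int.cast_neg, Int.cast_ofNat]
      norm_num
    change w (algebraMap (↥O) (AlgebraicClosure (v.adicCompletion K)) M.Δ) = 1
    rw [h1, hM, h2]
    exact spectralValuation_intCast_eq_one hw h343
  exact exists_reductionKernel (cm7.baseChange K) hw M hΔ hM

end Summit.BirchSwinnertonDyer.BirchSwinnertonDyer.Theorems.PrintCf2.ReductionKernel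

end
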